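import Summits.Ventures.YMGap.RobustBall.EnergyConcentrationDLR
import Summits.Ventures.YMGap.RobustBall.HeatBathPoincareZdBallDLR
import Summits.Ventures.YMGap.Thresholds.OneLinkModulusSU3Twisted
import HarnessLib

/-!
# Robust ball (Y2) — THE CONNECTED PLAQUETTE TWO-POINT FUNCTION IS A UNIFORMLY BOUNDED QUADRATIC FORM ON `ℓ²(plaquettes)` IN EVERY GIBBS STATE

HONEST FRAMING: venture file of the cell `pub-ymgap` (QuantumFields programme), track ROBUST-BALL, seat rb-p2 (g15); a corollary of the oscillation form of the
heat-bath Poincaré inequality of EVERY DLR state (`HeatBathPoincareZd.gibbsVariance_le_sum_osc_sq`, g12) in the style of `EnergyConcentrationDLR.lean` (g14, the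
case of indicator weights).  LATTICE statements at STRONG COUPLING, Wilson action (class K); nothing about `β → ∞`, the continuum or Clay.

THE STATEMENT.  `W_p = (1/N) Re tr U_p` (tree `zdPlaquetteObs`), `w : plaquettes → ℝ` ANY finitely supported test function (support `P`).  On the Kantorovich–
Rubinstein window (`OneLinkKRModulus N R K`, `R ≥ 2(d−1)|β|`, `6(d−1)|β|K ≤ c < 1`), for EVERY DLR state `μ`:
`Var_μ(∑_p w_p W_p) = ∑_{p,q} w_p w_q Cov_μ(W_p, W_q) ≤ (16(d−1)/(1−c)) ∑_p w_p²`
(`gibbs_variance_weightedPlaquetteSum_le_of_oneLinkKRModulus`, `gibbs_covarianceForm_plaquette_le_of_oneLinkKRModulus`): the connected two-point function of the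
plaquette field, as a quadratic form on test functions, is bounded by `16(d−1)/(1−c)` times the `ℓ²` norm — uniformly in the Gibbs state and WITHOUT the
`m^{−d}`-type factor of bounds obtained by summing exponential clustering (the tree's susceptibility column `PlaquetteSusceptibility` / `KernelSusceptibility` has
that shape).  ★★ `su2_gibbs_variance_weightedPlaquetteSum_le` / `su2_gibbs_covarianceForm_plaquette_le`: `SU(2)`, `d = 4`, `0 ≤ β_W < 2/9` (tree coupling `β_W/2`):
`∑_{p,q} w_p w_q Cov_μ(W_p, W_q) ≤ (96/(2 − 9β_W)) ∑_p w_p²` for every DLR state and every finitely supported `w` — the smeared plaquette field `W(w) = ∑ w_p W_p`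
has variance at most `96‖w‖₂²/(2 − 9β_W)` (indicator weights `w = 1_P/|P|` recover g14's `Var_μ(A_P) ≤ 96/((2 − 9β_W)|P|)`); `su2_gibbs_covarianceForm_plaquette_le_dim3`: `d = 3`, `0 ≤ β_W < 1/3`,
constant `32/(1 − 3β_W)`; `su3_gibbs_covarianceForm_plaquette_le_pv2t`: `SU(3)`, `d = 4`, engine-2's twisted modulus, `0 ≤ β_W < 1000/3531`, constant
`48/(1 − 3531β_W/1000)`.
Mechanism: `W(w)` is a Lipschitz cylinder with link oscillations `δ_x ≤ 2 ∑_{p ∋ x} |w_p|`; Cauchy–Schwarz over the `≤ 2(d−1)` plaquettes through a link and double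
counting (`≤ 4` links per plaquette) give `∑_x δ_x² ≤ 32(d−1)‖w‖₂²`; then the oscillation form of the Gibbs-state Poincaré inequality; the covariance form is Mathlib's
`variance_fun_sum'`.  BALL: `gibbs_variance_weightedPlaquetteSum_le_onBall` — the same variance bound, ONE constant `(2(1−c))⁻¹·32(d−1)`, for every DLR state of
every member of the `ℤ^d` ball under the hypotheses of `HeatBathPoincareZd.gibbsVariance_le_onBall`.  0 sorry, 0 definitions.  References: L. Wu, Ann. Probab. 34 (2006) 1960 (Poincaré under Dobrushin); B. Simon, The Statistical Mechanics of
Lattice Gases I (1993) §II.12 (susceptibility bounds from clustering, for comparison).  Everything here is proved. [folklore]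
-/

noncomputable section

open MeasureTheory Function Real Finset ProbabilityTheory Filter Topology
open scoped NNReal
open Literature.Probability.LatticeModels Literature.Probability.LatticeModels.DobrushinMetric
open Literature.MathematicalPhysics.QuantumLattice hiding torusNorm
open Literature.MathematicalPhysics.QuantumFieldTheory hiding ZdEdge Site
open Literature.MathematicalPhysics.QuantumFieldTheory.Balaban1983to89.StrongCouplingDobrushinWindow (OneLinkKRModulus)

namespace Summit.Ventures.YMGap.RobustBall.HeatBathConcentration

variable {d N : ℕ}

/-! ### The smeared plaquette field `W(w) = ∑_p w_p W_p` -/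

section Smeared

/-- **The smeared plaquette field is a Lipschitz cylinder** on the links of the support, constant `(∑_p |w_p|)·4N³`. [folklore] -/
theorem isLipschitzCylinder_weightedPlaquetteSum (P : Finset (ZdPlaquette d)) (w : ZdPlaquette d → ℝ) :
    IsLipschitzCylinder (fundamentalRep (Fin N))
      (fun U => ∑ p ∈ P, w p * zdPlaquetteObs (d := d) (fundamentalRep (Fin N)) p.1 p.2.1.1 p.2.1.2 U)
      (P.biUnion plaquetteEdges) ((∑ p ∈ P, ‖w p‖₊) * (4 * (N : ℝ≥0) ^ 3)) := by
  classical
  set S := P.biUnion plaquetteEdges with hS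
  refine ZdSmoothing.isLipschitzCylinder_of_dist_le fun U V => ?_
  set δ := dist (fun e : ↥S => suEntries (U e)) (fun e : ↥S => suEntries (V e)) with hδ
  have hδ0 : 0 ≤ δ := dist_nonneg
  have hterm : ∀ p ∈ P, |w p * zdPlaquetteObs (d := d) (fundamentalRep (Fin N)) p.1 p.2.1.1 p.2.1.2 U -
      w p * zdPlaquetteObs (d := d) (fundamentalRep (Fin N)) p.1 p.2.1.1 p.2.1.2 V| ≤ |w p| * ((4 * (N : ℝ≥0) ^ 3 : ℝ≥0) * δ) := by
    intro p hp
    have hL := isLipschitzCylinder_zdPlaquetteObs (N := N) (d := d) p.1 (i := p.2.1.1) (j := p.2.1.2) p.2.2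
    obtain ⟨f, hf, hF⟩ := hL.exists_suEntries
    rw [← mul_sub, abs_mul, hF, hF, ← Real.dist_eq]
    refine mul_le_mul_of_nonneg_left ((hf.dist_le_mul _ _).trans (mul_le_mul_of_nonneg_left ?_ (by positivity))) (abs_nonneg _)
    exact CouplingResponse.dist_restrict_le (Finset.subset_biUnion_of_mem plaquetteEdges hp) U V
  rw [← Finset.sum_sub_distrib]
  calc |∑ p ∈ P, (w p * zdPlaquetteObs (d := d) (fundamentalRep (Fin N)) p.1 p.2.1.1 p.2.1.2 U -
        w p * zdPlaquetteObs (d := d) (fundamentalRep (Fin N)) p.1 p.2.1.1 p.2.1.2 V)|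
      ≤ ∑ p ∈ P, |w p| * ((4 * (N : ℝ≥0) ^ 3 : ℝ≥0) * δ) := (Finset.abs_sum_le_sum_abs _ _).trans (Finset.sum_le_sum hterm)
    _ = (((∑ p ∈ P, ‖w p‖₊) * (4 * (N : ℝ≥0) ^ 3) : ℝ≥0) : ℝ) * δ := by
        rw [← Finset.sum_mul]; push_cast; simp only [Real.norm_eq_abs]; ring

/-- **Link oscillation of the smeared field**: changing the link `x` moves `W(w)` by at most `2 ∑_{p ∈ P, x ∈ ∂p} |w_p|`. [folklore] -/
theorem abs_weightedPlaquetteSum_sub_update_le (P : Finset (ZdPlaquette d)) (w : ZdPlaquette d → ℝ) (x : ZdEdge d)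
    (U : LGConfig d (Matrix.specialUnitaryGroup (Fin N) ℂ)) (s : Matrix.specialUnitaryGroup (Fin N) ℂ) :
    |∑ p ∈ P, w p * zdPlaquetteObs (d := d) (fundamentalRep (Fin N)) p.1 p.2.1.1 p.2.1.2 U -
        ∑ p ∈ P, w p * zdPlaquetteObs (d := d) (fundamentalRep (Fin N)) p.1 p.2.1.1 p.2.1.2 (update U x s)| ≤
      2 * ∑ p ∈ P.filter (fun p => x ∈ plaquetteEdges p), |w p| := by
  classical
  have hterm : ∀ p ∈ P, |w p * zdPlaquetteObs (d := d) (fundamentalRep (Fin N)) p.1 p.2.1.1 p.2.1.2 U -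
      w p * zdPlaquetteObs (d := d) (fundamentalRep (Fin N)) p.1 p.2.1.1 p.2.1.2 (update U x s)| ≤
        if x ∈ plaquetteEdges p then 2 * |w p| else 0 := by
    intro p _
    rw [← mul_sub, abs_mul]
    split_ifs with hx
    · have h : |zdPlaquetteObs (d := d) (fundamentalRep (Fin N)) p.1 p.2.1.1 p.2.1.2 U -
          zdPlaquetteObs (d := d) (fundamentalRep (Fin N)) p.1 p.2.1.1 p.2.1.2 (update U x s)| ≤ 2 :=
        calc _ ≤ |zdPlaquetteObs (d := d) (fundamentalRep (Fin N)) p.1 p.2.1.1 p.2.1.2 U| +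
              |zdPlaquetteObs (d := d) (fundamentalRep (Fin N)) p.1 p.2.1.1 p.2.1.2 (update U x s)| := abs_sub _ _
          _ ≤ 1 + 1 := add_le_add (abs_plaquetteObs_le_one p U) (abs_plaquetteObs_le_one p _)
          _ = 2 := by norm_num
      nlinarith [abs_nonneg (w p)]
    · have hdep := (isLipschitzCylinder_zdPlaquetteObs (N := N) (d := d) p.1 (i := p.2.1.1) (j := p.2.1.2) p.2.2).dependsOn
      have heq : zdPlaquetteObs (d := d) (fundamentalRep (Fin N)) p.1 p.2.1.1 p.2.1.2 (update U x s) =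
          zdPlaquetteObs (d := d) (fundamentalRep (Fin N)) p.1 p.2.1.1 p.2.1.2 U :=
        hdep fun e (he : e ∈ (↑(plaquetteEdges p) : Set (ZdEdge d))) => update_of_ne (fun h => hx (by rw [← h]; exact Finset.mem_coe.1 he)) _ _
      rw [heq, sub_self, abs_zero, mul_zero]
  rw [← Finset.sum_sub_distrib]
  calc |∑ p ∈ P, (w p * zdPlaquetteObs (d := d) (fundamentalRep (Fin N)) p.1 p.2.1.1 p.2.1.2 U -
        w p * zdPlaquetteObs (d := d) (fundamentalRep (Fin N)) p.1 p.2.1.1 p.2.1.2 (update U x s))|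
      ≤ ∑ p ∈ P, (if x ∈ plaquetteEdges p then 2 * |w p| else 0) := (Finset.abs_sum_le_sum_abs _ _).trans (Finset.sum_le_sum hterm)
    _ = 2 * ∑ p ∈ P.filter (fun p => x ∈ plaquetteEdges p), |w p| := by rw [Finset.sum_ite, Finset.sum_const_zero, add_zero, Finset.mul_sum]

/-- **`∑_x (2 ∑_{p ∋ x} |w_p|)² ≤ 32(d−1) ∑_p w_p²`** (Cauchy–Schwarz over the `≤ 2(d−1)` plaquettes through a link; `≤ 4` links per plaquette). [folklore] -/
theorem sum_sq_osc_weightedPlaquetteSum_le (hd : 1 ≤ d) (P : Finset (ZdPlaquette d)) (w : ZdPlaquette d → ℝ) :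
    ∑ x ∈ P.biUnion plaquetteEdges, (2 * ∑ p ∈ P.filter (fun p => x ∈ plaquetteEdges p), |w p|) ^ 2 ≤
      32 * ((d : ℝ) - 1) * ∑ p ∈ P, w p ^ 2 := by
  classical
  set S := P.biUnion plaquetteEdges with hS
  set A : ZdEdge d → Finset (ZdPlaquette d) := fun x => P.filter fun p => x ∈ plaquetteEdges p with hA
  have hd0 : (0 : ℝ) ≤ (d : ℝ) - 1 := by
    have : (1 : ℝ) ≤ d := by exact_mod_cast hd
    linarith
  -- `#A_x ≤ 2(d−1)`
  have hcard : ∀ x, ((A x).card : ℝ) ≤ 2 * ((d : ℝ) - 1) := fun x => by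
    have h1 : (A x).card ≤ (plaquettesTouching {x}).card := by
      refine Finset.card_le_card fun p hp => ?_
      rw [mem_plaquettesTouching_iff]
      exact ⟨x, Finset.mem_inter.2 ⟨(Finset.mem_filter.1 hp).2, Finset.mem_singleton_self x⟩⟩
    have h2 := card_plaquettesTouching_singleton_le x
    have h3 : ((2 * (d - 1) : ℕ) : ℝ) = 2 * ((d : ℝ) - 1) := by push_cast [Nat.cast_sub hd]; ring
    rw [← h3]; exact_mod_cast h1.trans h2
  -- Cauchy–Schwarz at each link
  have hcs : ∀ x ∈ S, (2 * ∑ p ∈ A x, |w p|) ^ 2 ≤ 8 * ((d : ℝ) - 1) * ∑ p ∈ A x, w p ^ 2 := fun x _ => by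
    have h1 : (∑ p ∈ A x, |w p|) ^ 2 ≤ (A x).card * ∑ p ∈ A x, |w p| ^ 2 := sq_sum_le_card_mul_sum_sq
    have h2 : ∑ p ∈ A x, |w p| ^ 2 = ∑ p ∈ A x, w p ^ 2 := Finset.sum_congr rfl fun p _ => sq_abs _
    rw [h2] at h1
    have h3 : 0 ≤ ∑ p ∈ A x, w p ^ 2 := Finset.sum_nonneg fun p _ => sq_nonneg _
    nlinarith [hcard x, h1, h3]
  -- double counting: `∑_{x ∈ S} ∑_{p ∈ A_x} w_p² ≤ 4 ∑_p w_p²`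
  have hdc : ∑ x ∈ S, ∑ p ∈ A x, w p ^ 2 ≤ 4 * ∑ p ∈ P, w p ^ 2 := by
    have h1 : ∀ x, ∑ p ∈ A x, w p ^ 2 = ∑ p ∈ P, if x ∈ plaquetteEdges p then w p ^ 2 else 0 := fun x => by
      rw [hA, Finset.sum_filter]
    have h2 : ∑ x ∈ S, ∑ p ∈ A x, w p ^ 2 = ∑ p ∈ P, ∑ x ∈ S, if x ∈ plaquetteEdges p then w p ^ 2 else 0 := by
      rw [Finset.sum_comm]; exact Finset.sum_congr rfl fun x _ => h1 x
    have h3 : ∀ p ∈ P, ∑ x ∈ S, (if x ∈ plaquetteEdges p then w p ^ 2 else 0) ≤ 4 * w p ^ 2 := fun p hp => by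
      rw [Finset.sum_ite, Finset.sum_const_zero, add_zero, Finset.sum_const, nsmul_eq_mul]
      have hsub : S.filter (fun x => x ∈ plaquetteEdges p) ⊆ plaquetteEdges p := fun x hx => (Finset.mem_filter.1 hx).2
      have hc : ((S.filter fun x => x ∈ plaquetteEdges p).card : ℝ) ≤ 4 := by
        exact_mod_cast (Finset.card_le_card hsub).trans (card_plaquetteEdges_le p)
      nlinarith [sq_nonneg (w p)]
    rw [h2]
    calc ∑ p ∈ P, ∑ x ∈ S, (if x ∈ plaquetteEdges p then w p ^ 2 else 0) ≤ ∑ p ∈ P, 4 * w p ^ 2 := Finset.sum_le_sum h3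
      _ = 4 * ∑ p ∈ P, w p ^ 2 := by rw [Finset.mul_sum]
  calc ∑ x ∈ S, (2 * ∑ p ∈ A x, |w p|) ^ 2 ≤ ∑ x ∈ S, 8 * ((d : ℝ) - 1) * ∑ p ∈ A x, w p ^ 2 := Finset.sum_le_sum hcs
    _ = 8 * ((d : ℝ) - 1) * ∑ x ∈ S, ∑ p ∈ A x, w p ^ 2 := by rw [Finset.mul_sum]
    _ ≤ 8 * ((d : ℝ) - 1) * (4 * ∑ p ∈ P, w p ^ 2) := mul_le_mul_of_nonneg_left hdc (by positivity)
    _ = 32 * ((d : ℝ) - 1) * ∑ p ∈ P, w p ^ 2 := by ring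

end Smeared

/-! ### The variance / covariance-form bound in every Gibbs state -/

section Gibbs

/-- ★★ **THE SMEARED PLAQUETTE FIELD HAS VARIANCE `≤ 16(d−1)‖w‖₂²/(1−c)` IN EVERY GIBBS STATE** (every `SU(N)`, `d ≥ 2`, KR window): for every DLR state `μ`,
every finite plaquette set `P` and every weight `w`, `Var_μ(∑_{p∈P} w_p W_p) ≤ (2(1−c))⁻¹ · 32(d−1) ∑_{p∈P} w_p²`. [folklore] -/
theorem gibbs_variance_weightedPlaquetteSum_le_of_oneLinkKRModulus (hd : 2 ≤ d) (hN : 1 ≤ N) {β R K c : ℝ} (hK : 0 ≤ K)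
    (hR : |β| * (2 * ((d : ℝ) - 1)) ≤ R) (hmod : OneLinkKRModulus N R K) (hc : 6 * ((d : ℝ) - 1) * |β| * K ≤ c) (hc1 : c < 1)
    {μ : Measure (LGConfig d (Matrix.specialUnitaryGroup (Fin N) ℂ))}
    (hμ : μ ∈ ymGibbsMeasures (d := d) (fundamentalRep (Fin N)) (N * β))
    (P : Finset (ZdPlaquette d)) (w : ZdPlaquette d → ℝ) :
    ProbabilityTheory.variance (fun U => ∑ p ∈ P, w p * zdPlaquetteObs (d := d) (fundamentalRep (Fin N)) p.1 p.2.1.1 p.2.1.2 U) μ ≤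
      (2 * (1 - c))⁻¹ * (32 * ((d : ℝ) - 1) * ∑ p ∈ P, w p ^ 2) := by
  classical
  have hd1 : 1 ≤ d := by omega
  have hc0 : 0 < 2 * (1 - c) := by linarith
  have h := HeatBathPoincareZd.gibbsVariance_le_sum_osc_sq hd1 hN hK hR hmod hc hc1 hμ (isLipschitzCylinder_weightedPlaquetteSum (N := N) (d := d) P w)
    (fun x => 2 * ∑ p ∈ P.filter (fun p => x ∈ plaquetteEdges p), |w p|) (fun x U s => abs_weightedPlaquetteSum_sub_update_le P w x U s)
  exact h.trans (mul_le_mul_of_nonneg_left (sum_sq_osc_weightedPlaquetteSum_le (d := d) hd1 P w) (inv_nonneg.2 hc0.le))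

/-- ★★ **COVARIANCE FORM — THE CONNECTED PLAQUETTE TWO-POINT FUNCTION IS A BOUNDED QUADRATIC FORM ON `ℓ²`**: for every DLR state `μ` on the window, every finite
plaquette set `P` and every weight `w`, `∑_{p,q∈P} w_p w_q Cov_μ(W_p, W_q) ≤ (2(1−c))⁻¹ · 32(d−1) ∑_{p∈P} w_p²` — operator norm `≤ 16(d−1)/(1−c)`, uniformly in
the Gibbs state. [folklore] -/
theorem gibbs_covarianceForm_plaquette_le_of_oneLinkKRModulus (hd : 2 ≤ d) (hN : 1 ≤ N) {β R K c : ℝ} (hK : 0 ≤ K)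
    (hR : |β| * (2 * ((d : ℝ) - 1)) ≤ R) (hmod : OneLinkKRModulus N R K) (hc : 6 * ((d : ℝ) - 1) * |β| * K ≤ c) (hc1 : c < 1)
    {μ : Measure (LGConfig d (Matrix.specialUnitaryGroup (Fin N) ℂ))}
    (hμ : μ ∈ ymGibbsMeasures (d := d) (fundamentalRep (Fin N)) (N * β))
    (P : Finset (ZdPlaquette d)) (w : ZdPlaquette d → ℝ) :
    ∑ p ∈ P, ∑ q ∈ P, w p * w q *
        cov[zdPlaquetteObs (d := d) (fundamentalRep (Fin N)) p.1 p.2.1.1 p.2.1.2,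
          zdPlaquetteObs (d := d) (fundamentalRep (Fin N)) q.1 q.2.1.1 q.2.1.2; μ] ≤
      (2 * (1 - c))⁻¹ * (32 * ((d : ℝ) - 1) * ∑ p ∈ P, w p ^ 2) := by
  classical
  haveI : SecondCountableTopology (Matrix (Fin N) (Fin N) ℂ) :=
    inferInstanceAs (SecondCountableTopology (Fin N → Fin N → ℂ))
  haveI : SecondCountableTopology (Matrix.specialUnitaryGroup (Fin N) ℂ) :=
    Topology.IsEmbedding.subtypeVal.secondCountableTopology
  have hγ : IsSpecification (ymSpecification (d := d) (fundamentalRep (Fin N)) (N * β)) :=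
    isSpecification_ymSpecification_of_t2Space _ (continuous_fundamentalRep (Fin N)) _
  have hμ' : IsGibbsMeasure (ymSpecification (d := d) (fundamentalRep (Fin N)) (N * β)) μ := hμ
  haveI := hμ'.isProbabilityMeasure
  -- each `w_p W_p` is in `L²(μ)` (bounded measurable)
  have hmem : ∀ p ∈ P, MemLp (fun U => w p * zdPlaquetteObs (d := d) (fundamentalRep (Fin N)) p.1 p.2.1.1 p.2.1.2 U) 2 μ := by
    intro p _
    have hm : Measurable (zdPlaquetteObs (d := d) (fundamentalRep (Fin N)) p.1 p.2.1.1 p.2.1.2) :=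
      (isLipschitzCylinder_zdPlaquetteObs (N := N) (d := d) p.1 (i := p.2.1.1) (j := p.2.1.2) p.2.2).measurable
    refine memLp_of_bounded (a := -|w p|) (b := |w p|) (ae_of_all _ fun U => ?_) ((measurable_const.mul hm).aestronglyMeasurable) 2
    have h1 : |w p * zdPlaquetteObs (d := d) (fundamentalRep (Fin N)) p.1 p.2.1.1 p.2.1.2 U| ≤ |w p| := by
      rw [abs_mul]; exact mul_le_of_le_one_right (abs_nonneg _) (abs_plaquetteObs_le_one p U)
    exact ⟨(abs_le.1 h1).1, (abs_le.1 h1).2⟩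
  have hvar := variance_fun_sum' (μ := μ) hmem
  have hcov : ∀ p ∈ P, ∀ q ∈ P,
      cov[fun U => w p * zdPlaquetteObs (d := d) (fundamentalRep (Fin N)) p.1 p.2.1.1 p.2.1.2 U,
        fun U => w q * zdPlaquetteObs (d := d) (fundamentalRep (Fin N)) q.1 q.2.1.1 q.2.1.2 U; μ] =
      w p * w q * cov[zdPlaquetteObs (d := d) (fundamentalRep (Fin N)) p.1 p.2.1.1 p.2.1.2,
        zdPlaquetteObs (d := d) (fundamentalRep (Fin N)) q.1 q.2.1.1 q.2.1.2; μ] := fun p _ q _ => by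
    rw [covariance_const_mul_left, covariance_const_mul_right, mul_assoc]
  have heq : ∑ p ∈ P, ∑ q ∈ P, w p * w q *
        cov[zdPlaquetteObs (d := d) (fundamentalRep (Fin N)) p.1 p.2.1.1 p.2.1.2,
          zdPlaquetteObs (d := d) (fundamentalRep (Fin N)) q.1 q.2.1.1 q.2.1.2; μ] =
      ProbabilityTheory.variance (fun U => ∑ p ∈ P, w p * zdPlaquetteObs (d := d) (fundamentalRep (Fin N)) p.1 p.2.1.1 p.2.1.2 U) μ := by
    rw [hvar]
    exact Finset.sum_congr rfl fun p hp => Finset.sum_congr rfl fun q hq => (hcov p hp q hq).symm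
  rw [heq]
  exact gibbs_variance_weightedPlaquetteSum_le_of_oneLinkKRModulus hd hN hK hR hmod hc hc1 hμ P w

/-- ★★ **`SU(2)`, `d = 4`, HYPOTHESIS-FREE on `0 ≤ β_W < 2/9`** (tree coupling `β_W/2`): for EVERY DLR state `μ` of 4D `SU(2)` lattice Yang–Mills, every finite plaquette
set `P` and every weight `w`, the smeared plaquette field satisfies `Var_μ(∑_{p∈P} w_p W_p) ≤ (96/(2 − 9β_W)) ∑_{p∈P} w_p²`. [folklore] -/
theorem su2_gibbs_variance_weightedPlaquetteSum_le {βW : ℝ} (h0 : 0 ≤ βW) (h : βW < 2 / 9)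
    {μ : Measure (LGConfig 4 (Matrix.specialUnitaryGroup (Fin 2) ℂ))}
    (hμ : μ ∈ ymGibbsMeasures (d := 4) (fundamentalRep (Fin 2)) (βW / 2)) (P : Finset (ZdPlaquette 4)) (w : ZdPlaquette 4 → ℝ) :
    ProbabilityTheory.variance (fun U => ∑ p ∈ P, w p * zdPlaquetteObs (d := 4) (fundamentalRep (Fin 2)) p.1 p.2.1.1 p.2.1.2 U) μ ≤
      96 / (2 - 9 * βW) * ∑ p ∈ P, w p ^ 2 := by
  have hβ : ((2 : ℕ) : ℝ) * (βW / 4) = βW / 2 := by push_cast; ring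
  have habs : |βW / 4| = βW / 4 := abs_of_nonneg (by positivity)
  have hμ4 : μ ∈ ymGibbsMeasures (d := 4) (fundamentalRep (Fin 2)) ((2 : ℕ) * (βW / 4)) := by rwa [hβ]
  have key := gibbs_variance_weightedPlaquetteSum_le_of_oneLinkKRModulus (d := 4) (N := 2) (by norm_num) (by norm_num) (β := βW / 4) (R := 3 * βW / 2)
    zero_le_one (by rw [habs]; norm_num; linarith) (SlabAreaLawDimensions.su2_oneLinkKRModulus_of_le_one (by linarith)) (c := 9 * βW / 2)
    (by rw [habs]; norm_num; linarith) (by linarith) hμ4 P w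
  have hc0 : 0 < 2 - 9 * βW := by linarith
  have e : (2 * (1 - 9 * βW / 2))⁻¹ * (32 * (((4 : ℕ) : ℝ) - 1) * ∑ p ∈ P, w p ^ 2) = 96 / (2 - 9 * βW) * ∑ p ∈ P, w p ^ 2 := by
    push_cast; field_simp; ring
  rw [e] at key
  exact key

/-- ★★ **`SU(2)`, `d = 4`, `0 ≤ β_W < 2/9`, COVARIANCE FORM**: `∑_{p,q∈P} w_p w_q Cov_μ(W_p, W_q) ≤ (96/(2 − 9β_W)) ∑_{p∈P} w_p²` for EVERY DLR state and every
finitely supported test function — the connected plaquette two-point function of the strong-coupling state is a quadratic form of norm `≤ 96/(2 − 9β_W)` on `ℓ²`.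
[folklore] -/
theorem su2_gibbs_covarianceForm_plaquette_le {βW : ℝ} (h0 : 0 ≤ βW) (h : βW < 2 / 9)
    {μ : Measure (LGConfig 4 (Matrix.specialUnitaryGroup (Fin 2) ℂ))}
    (hμ : μ ∈ ymGibbsMeasures (d := 4) (fundamentalRep (Fin 2)) (βW / 2)) (P : Finset (ZdPlaquette 4)) (w : ZdPlaquette 4 → ℝ) :
    ∑ p ∈ P, ∑ q ∈ P, w p * w q *
        cov[zdPlaquetteObs (d := 4) (fundamentalRep (Fin 2)) p.1 p.2.1.1 p.2.1.2,
          zdPlaquetteObs (d := 4) (fundamentalRep (Fin 2)) q.1 q.2.1.1 q.2.1.2; μ] ≤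
      96 / (2 - 9 * βW) * ∑ p ∈ P, w p ^ 2 := by
  have hβ : ((2 : ℕ) : ℝ) * (βW / 4) = βW / 2 := by push_cast; ring
  have habs : |βW / 4| = βW / 4 := abs_of_nonneg (by positivity)
  have hμ4 : μ ∈ ymGibbsMeasures (d := 4) (fundamentalRep (Fin 2)) ((2 : ℕ) * (βW / 4)) := by rwa [hβ]
  have key := gibbs_covarianceForm_plaquette_le_of_oneLinkKRModulus (d := 4) (N := 2) (by norm_num) (by norm_num) (β := βW / 4) (R := 3 * βW / 2)
    zero_le_one (by rw [habs]; norm_num; linarith) (SlabAreaLawDimensions.su2_oneLinkKRModulus_of_le_one (by linarith)) (c := 9 * βW / 2)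
    (by rw [habs]; norm_num; linarith) (by linarith) hμ4 P w
  have hc0 : 0 < 2 - 9 * βW := by linarith
  have e : (2 * (1 - 9 * βW / 2))⁻¹ * (32 * (((4 : ℕ) : ℝ) - 1) * ∑ p ∈ P, w p ^ 2) = 96 / (2 - 9 * βW) * ∑ p ∈ P, w p ^ 2 := by
    push_cast; field_simp; ring
  rw [e] at key
  exact key

/-- ★ **`SU(2)`, `d = 3`, HYPOTHESIS-FREE on `0 ≤ β_W < 1/3`** (tree coupling `β_W/2`, quarter modulus, `c = 3β_W`): for EVERY DLR state `μ` of 3D `SU(2)` lattice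
Yang–Mills, every finite plaquette set `P` and every weight `w`, `∑_{p,q∈P} w_p w_q Cov_μ(W_p, W_q) ≤ (32/(1 − 3β_W)) ∑_{p∈P} w_p²`. [folklore] -/
theorem su2_gibbs_covarianceForm_plaquette_le_dim3 {βW : ℝ} (h0 : 0 ≤ βW) (h : βW < 1 / 3)
    {μ : Measure (LGConfig 3 (Matrix.specialUnitaryGroup (Fin 2) ℂ))}
    (hμ : μ ∈ ymGibbsMeasures (d := 3) (fundamentalRep (Fin 2)) (βW / 2)) (P : Finset (ZdPlaquette 3)) (w : ZdPlaquette 3 → ℝ) :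
    ∑ p ∈ P, ∑ q ∈ P, w p * w q *
        cov[zdPlaquetteObs (d := 3) (fundamentalRep (Fin 2)) p.1 p.2.1.1 p.2.1.2,
          zdPlaquetteObs (d := 3) (fundamentalRep (Fin 2)) q.1 q.2.1.1 q.2.1.2; μ] ≤
      32 / (1 - 3 * βW) * ∑ p ∈ P, w p ^ 2 := by
  have hβ : ((2 : ℕ) : ℝ) * (βW / 4) = βW / 2 := by push_cast; ring
  have habs : |βW / 4| = βW / 4 := abs_of_nonneg (by positivity)
  have hμ4 : μ ∈ ymGibbsMeasures (d := 3) (fundamentalRep (Fin 2)) ((2 : ℕ) * (βW / 4)) := by rwa [hβ]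
  have key := gibbs_covarianceForm_plaquette_le_of_oneLinkKRModulus (d := 3) (N := 2) (by norm_num) (by norm_num) (β := βW / 4) (R := βW)
    zero_le_one (by rw [habs]; norm_num) (SlabAreaLawDimensions.su2_oneLinkKRModulus_of_le_one (by linarith)) (c := 3 * βW)
    (by rw [habs]; norm_num; linarith) (by linarith) hμ4 P w
  have hc0 : 0 < 1 - 3 * βW := by linarith
  have e : (2 * (1 - 3 * βW))⁻¹ * (32 * (((3 : ℕ) : ℝ) - 1) * ∑ p ∈ P, w p ^ 2) = 32 / (1 - 3 * βW) * ∑ p ∈ P, w p ^ 2 := by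
    push_cast; field_simp; ring
  rw [e] at key
  exact key

/-- ★ **`SU(3)`, `d = 4`, TWISTED MODULUS `OneLinkKRModulus 3 (1/5) (3531/2000)`, HYPOTHESIS-FREE on `0 ≤ β_W < 1000/3531`** (tree coupling `β_W/3`): for EVERY DLR state
`μ` of 4D `SU(3)` lattice Yang–Mills, every finite plaquette set `P` and every weight `w`, `∑_{p,q∈P} w_p w_q Cov_μ(W_p, W_q) ≤ (48/(1 − 3531β_W/1000)) ∑_{p∈P} w_p²`.
[folklore] -/
theorem su3_gibbs_covarianceForm_plaquette_le_pv2t {βW : ℝ} (h0 : 0 ≤ βW) (h : βW < 1000 / 3531)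
    {μ : Measure (LGConfig 4 (Matrix.specialUnitaryGroup (Fin 3) ℂ))}
    (hμ : μ ∈ ymGibbsMeasures (d := 4) (fundamentalRep (Fin 3)) (βW / 3)) (P : Finset (ZdPlaquette 4)) (w : ZdPlaquette 4 → ℝ) :
    ∑ p ∈ P, ∑ q ∈ P, w p * w q *
        cov[zdPlaquetteObs (d := 4) (fundamentalRep (Fin 3)) p.1 p.2.1.1 p.2.1.2,
          zdPlaquetteObs (d := 4) (fundamentalRep (Fin 3)) q.1 q.2.1.1 q.2.1.2; μ] ≤
      48 / (1 - 3531 * βW / 1000) * ∑ p ∈ P, w p ^ 2 := by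
  have hβ : ((3 : ℕ) : ℝ) * (βW / 9) = βW / 3 := by push_cast; ring
  have habs : |βW / 9| = βW / 9 := abs_of_nonneg (by positivity)
  have hμ9 : μ ∈ ymGibbsMeasures (d := 4) (fundamentalRep (Fin 3)) (((3 : ℕ) : ℝ) * (βW / 9)) := by rwa [hβ]
  have key := gibbs_covarianceForm_plaquette_le_of_oneLinkKRModulus (d := 4) (N := 3) (by norm_num) (by norm_num) (β := βW / 9) (by norm_num) (R := 1 / 5)
    (by rw [habs]; push_cast; linarith) TwistedBochner.su3_oneLinkKRModulus_pv2t_oneFifth (c := 3531 * βW / 1000)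
    (by rw [habs]; push_cast; linarith) (by linarith) hμ9 P w
  have hc0 : 0 < 1 - 3531 * βW / 1000 := by linarith
  have e : (2 * (1 - 3531 * βW / 1000))⁻¹ * (32 * (((4 : ℕ) : ℝ) - 1) * ∑ p ∈ P, w p ^ 2) = 48 / (1 - 3531 * βW / 1000) * ∑ p ∈ P, w p ^ 2 := by
    push_cast; field_simp; ring
  rw [e] at key
  exact key

end Gibbs

/-! ### The same on the `ℤ^d` ball: every Gibbs state of every member -/

section Ball

/-- ★★ **ON THE `ℤ^d` BALL**: under the hypotheses of `HeatBathPoincareZd.gibbsVariance_le_onBall` (member `W` with loads `(a, ℓ_s, Λ, Λc)`, range `R`, column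
condition `6(d−1)|β|K e^{a}(1 + 2√N ℓ_s) + √N Λc ≤ c < 1`, row condition `… + √N Λ < 1`), EVERY DLR state `μ` of the member, every finite plaquette set `P` and every
weight `w` satisfy `Var_μ(∑_{p∈P} w_p W_p) ≤ (2(1−c))⁻¹ · 32(d−1) ∑_{p∈P} w_p²` — ONE bound for the whole ball. [folklore] -/
theorem gibbs_variance_weightedPlaquetteSum_le_onBall (hd : 2 ≤ d) (hN : 1 ≤ N) {β b K a ℓs Λ Λc R c : ℝ} (hK : 0 ≤ K) (hℓs : 0 ≤ ℓs)
    (hb : |β| * (2 * ((d : ℝ) - 1)) ≤ b) (hmod : OneLinkKRModulus N b K)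
    {W : Potential (ZdEdge d) (Matrix.specialUnitaryGroup (Fin N) ℂ)} (hWc : ∀ X, Continuous (W X))
    (hWdep : ∀ X, DependsOn (W X) (↑X : Set (ZdEdge d)))
    {supp : Finset (ZdEdge d) → Finset (Finset (ZdEdge d))} (hsupp : W.IsSupportedBy supp)
    {osc : Finset (ZdEdge d) → ZdEdge d → ℝ} (hosc : ∀ X, Dobrushin.IsOscBound (W X) (osc X))
    (hosca : ∀ e, ∑ X ∈ (supp {e}).filter (fun X => e ∈ X), osc X e ≤ a)
    {lip : Finset (ZdEdge d) → ZdEdge d → ℝ} (hlip : ∀ X, IsLipBound suFrobDist (W X) (lip X))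
    (hlips : ∀ e, ∑ X ∈ (supp {e}).filter (fun X => e ∈ X), lip X e ≤ ℓs)
    (hΛ : ∀ e, ∑ y ∈ perturbedNbr supp e, ∑ X ∈ (supp {e}).filter (fun X => e ∈ X), lip X y ≤ Λ)
    (hcol : ∀ (y : ZdEdge d) (T : Finset (ZdEdge d)), y ∉ T → ∑ e ∈ T, ∑ X ∈ (supp {e}).filter (fun X => e ∈ X), lip X y ≤ Λc)
    (hR : ∀ e, ∀ X ∈ supp {e}, e ∈ X → ∀ y ∈ X, ‖e.1 - y.1‖ ≤ R)
    (hc : 6 * ((d : ℝ) - 1) * |β| * (K * Real.exp a * (1 + 2 * Real.sqrt N * ℓs)) + Real.sqrt N * Λc ≤ c) (hc1 : c < 1)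
    (hrow : 6 * ((d : ℝ) - 1) * |β| * (K * Real.exp a * (1 + 2 * Real.sqrt N * ℓs)) + Real.sqrt N * Λ < 1)
    {μ : Measure (LGConfig d (Matrix.specialUnitaryGroup (Fin N) ℂ))}
    (hμ : μ ∈ perturbedGibbsMeasures (d := d) (fundamentalRep (Fin N)) (N * β) W supp)
    (P : Finset (ZdPlaquette d)) (w : ZdPlaquette d → ℝ) :
    ProbabilityTheory.variance (fun U => ∑ p ∈ P, w p * zdPlaquetteObs (d := d) (fundamentalRep (Fin N)) p.1 p.2.1.1 p.2.1.2 U) μ ≤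
      (2 * (1 - c))⁻¹ * (32 * ((d : ℝ) - 1) * ∑ p ∈ P, w p ^ 2) := by
  classical
  haveI : SecondCountableTopology (Matrix (Fin N) (Fin N) ℂ) :=
    inferInstanceAs (SecondCountableTopology (Fin N → Fin N → ℂ))
  haveI : SecondCountableTopology (Matrix.specialUnitaryGroup (Fin N) ℂ) :=
    Topology.IsEmbedding.subtypeVal.secondCountableTopology
  have hd1 : 1 ≤ d := by omega
  have hρc := continuous_fundamentalRep (Fin N)
  have hWa : W.IsAdapted := fun X => ⟨hWdep X, (hWc X).measurable⟩
  have hWb : ∀ X, ∃ C, ∀ U, |W X U| ≤ C := fun X => exists_bound_of_continuous (hWc X)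
  have hγ : IsSpecification (perturbedYM (d := d) (fundamentalRep (Fin N)) (N * β) W supp) := isSpecification_perturbedYM _ hρc _ hWa hWb hsupp
  have hμ' : IsGibbsMeasure (perturbedYM (d := d) (fundamentalRep (Fin N)) (N * β) W supp) μ := hμ
  haveI := hμ'.isProbabilityMeasure
  have hc0 : 0 < 2 * (1 - c) := by linarith
  have hF := isLipschitzCylinder_weightedPlaquetteSum (N := N) (d := d) P w
  set δ : ZdEdge d → ℝ := fun x => 2 * ∑ p ∈ P.filter (fun p => x ∈ plaquetteEdges p), |w p| with hδ
  have h1 := HeatBathPoincareZd.gibbsVariance_le_onBall hd1 hN hK hℓs hb hmod hWc hWdep hsupp hosc hosca hlip hlips hΛ hcol hR hc hc1 hrow hμ hF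
  have h2 : ∀ x ∈ P.biUnion plaquetteEdges,
      ∫ U, ∫ σ, ((∑ p ∈ P, w p * zdPlaquetteObs (d := d) (fundamentalRep (Fin N)) p.1 p.2.1.1 p.2.1.2 U) -
          ∑ p ∈ P, w p * zdPlaquetteObs (d := d) (fundamentalRep (Fin N)) p.1 p.2.1.1 p.2.1.2 σ) ^ 2
        ∂(perturbedYM (fundamentalRep (Fin N)) (N * β) W supp {x} U) ∂μ ≤ δ x ^ 2 := fun x _ => by
    have hpt : ∀ U, ∫ σ, ((∑ p ∈ P, w p * zdPlaquetteObs (d := d) (fundamentalRep (Fin N)) p.1 p.2.1.1 p.2.1.2 U) -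
        ∑ p ∈ P, w p * zdPlaquetteObs (d := d) (fundamentalRep (Fin N)) p.1 p.2.1.1 p.2.1.2 σ) ^ 2
          ∂(perturbedYM (fundamentalRep (Fin N)) (N * β) W supp {x} U) ≤ δ x ^ 2 := fun U =>
      HeatBathPoincareZd.integral_sq_sub_le_sq hγ x hF.measurable U (fun s => abs_weightedPlaquetteSum_sub_update_le P w x U s)
    have h := integral_mono_of_nonneg (μ := μ) (ae_of_all _ fun U => integral_nonneg fun σ => sq_nonneg _)
      (integrable_const (δ x ^ 2)) (ae_of_all _ hpt)
    simpa using h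
  calc _ ≤ (2 * (1 - c))⁻¹ * ∑ x ∈ P.biUnion plaquetteEdges, δ x ^ 2 :=
        h1.trans (mul_le_mul_of_nonneg_left (Finset.sum_le_sum h2) (inv_nonneg.2 hc0.le))
    _ ≤ (2 * (1 - c))⁻¹ * (32 * ((d : ℝ) - 1) * ∑ p ∈ P, w p ^ 2) :=
        mul_le_mul_of_nonneg_left (sum_sq_osc_weightedPlaquetteSum_le (d := d) hd1 P w) (inv_nonneg.2 hc0.le)

end Ball

end Summit.Ventures.YMGap.RobustBall.HeatBathConcentration

end
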